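import Mathlib
import HarnessLib

/-!
# `NoHeavyLowerTail` (crux stmt-CriticalPhenomena-4575), antithetic vdBHK programme: the FIBRE (PICTURE) CRITERION for antipodal-Kleitman structures

Support file (seat `prim-ineq-gen-7` gen 20; `--supports stmt-CriticalPhenomena-4575`).  Nothing is asserted about the crux; no `sorry`,
no definitions.  Memo: run/shared/lean/prim/prim-ineq-gen-7/FINDING-RAA-g20.md §3.

SETTING (as in `…KnQuestion8AntitheticProduct`, `…KnQuestion8AntitheticCover`).  A finite preordered type `Ω` with a weight `μ ≥ 0` and an
order-reversing, `μ`-preserving involution `ι` is *antipodal Kleitman* (AK) if `Σ_u μ u · f u · (g u − g (ι u)) ≥ 0` for all monotone `f, g`.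
MASTER⁺ / ULEX / RAA for a rooted graph are AK statements for posets of edge 2-colourings.  This file adds tool **T11 (fibre criterion)**, the
abstract core of the *picture method* of the memo:

* `AntitheticPicture.sum_mul_sub_eq_half` — symmetrisation: `Σ μ f (g − gι) = ½ Σ μ (f − fι)(g − gι)`;
* `AntitheticPicture.monotone_sub_comp` — `f − f ∘ ι` is monotone when `f` is and `ι` reverses the order;
* `AntitheticPicture.ak_of_fibres` — **T11**: let `π : Ω → T` be ANY map ('picture').  If (i) on every fibre of `π` monotone functions are
  positively correlated (`(Σ_F μ a)(Σ_F μ b) ≤ (Σ_F μ)(Σ_F μ a b)`; e.g. the fibre is a product cube on which monotone functions are increasing —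
  Harris) and (ii) on every fibre the 'odd mass' `Σ_F μ (f − f∘ι)` has a constant sign over all monotone `f`, then `Ω` is AK.
  Proof: after symmetrisation the AK sum splits over fibres; on a fibre `F`, (i) applied to the monotone functions `f − fι`, `g − gι` gives
  `(Σ_F μ)·Σ_F μ(f−fι)(g−gι) ≥ (Σ_F μ(f−fι))(Σ_F μ(g−gι)) ≥ 0` by (ii).
* `AntitheticPicture.oddMass_nonpos_of_matching` — criterion for (ii): if a `μ`-preserving map `Φ` sends the fibre `F` injectively onto `ι(F)` with
  `u ≤ Φ u` on `F`, then `Σ_F μ (f − f∘ι) ≤ 0` for every monotone `f` (the fibre lies below its antipode).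
Application (memo §3, THEOREM A): for the rooted-antithetic-association poset of a graph with a PENDANT sink `t`, take `π s =` (red, blue edge
clusters of `t`); fibres are product cubes (conditional Harris) and flipping the cluster together with its edge boundary is the matching `Φ`;
hence RAA — and with it ULEX for every source and vdBHK-MASTER⁺ — holds for every finite (hyper)graph with a pendant sink.
-/

namespace Summit.CriticalPhenomena.PercolationContinuityZ3.Theorems

open Finset

namespace AntitheticPicture

variable {Ω : Type*}

/-- `f − f ∘ ι` is monotone when `f` is monotone and `ι` reverses the preorder. [this work] -/
theorem monotone_sub_comp [Preorder Ω] (ι : Ω → Ω) (hι : ∀ u v : Ω, u ≤ v → ι v ≤ ι u) (f : Ω → ℝ) (hf : Monotone f) :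
    Monotone (fun u => f u - f (ι u)) := by
  intro u v h
  exact sub_le_sub (hf h) (hf (hι u v h))

/-- **Symmetrisation.**  For a `μ`-preserving involution `ι`:
`Σ_u μ u · f u · (g u − g(ι u)) = ½ · Σ_u μ u · (f u − f(ι u)) · (g u − g(ι u))`. [this work] -/
theorem sum_mul_sub_eq_half [Fintype Ω] (μ : Ω → ℝ) (ι : Ω → Ω) (hιι : Function.Involutive ι) (hμι : ∀ u, μ (ι u) = μ u)
    (f g : Ω → ℝ) :
    ∑ u, μ u * (f u * (g u - g (ι u))) = (1 / 2) * ∑ u, μ u * ((f u - f (ι u)) * (g u - g (ι u))) := by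
  -- reindex two of the four terms by the involution
  have h1 : ∑ u, μ u * (f (ι u) * g (ι u)) = ∑ u, μ u * (f u * g u) := by
    have := Equiv.sum_comp (hιι.toPerm ι) (fun u => μ u * (f u * g u))
    simp only [Function.Involutive.coe_toPerm] at this
    rw [← this]
    refine Finset.sum_congr rfl (fun u _ => ?_)
    rw [hμι]
  have h2 : ∑ u, μ u * (f (ι u) * g u) = ∑ u, μ u * (f u * g (ι u)) := by
    have := Equiv.sum_comp (hιι.toPerm ι) (fun u => μ u * (f u * g (ι u)))
    simp only [Function.Involutive.coe_toPerm] at this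
    rw [← this]
    refine Finset.sum_congr rfl (fun u _ => ?_)
    rw [hμι, hιι u]
  have hexp : ∑ u, μ u * ((f u - f (ι u)) * (g u - g (ι u)))
      = ∑ u, μ u * (f u * g u) - ∑ u, μ u * (f u * g (ι u)) - ∑ u, μ u * (f (ι u) * g u)
        + ∑ u, μ u * (f (ι u) * g (ι u)) := by
    rw [← Finset.sum_sub_distrib, ← Finset.sum_sub_distrib, ← Finset.sum_add_distrib]
    refine Finset.sum_congr rfl (fun u _ => ?_)
    ring
  have hlhs : ∑ u, μ u * (f u * (g u - g (ι u))) = ∑ u, μ u * (f u * g u) - ∑ u, μ u * (f u * g (ι u)) := by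
    rw [← Finset.sum_sub_distrib]
    refine Finset.sum_congr rfl (fun u _ => ?_)
    ring
  rw [hexp, h1, h2, hlhs]
  ring

section Fibres

variable [Fintype Ω] [Preorder Ω] {T : Type*} [Fintype T] [DecidableEq T]

/-- **T11, the fibre (picture) criterion.**  `μ ≥ 0`, `ι` an order-reversing `μ`-preserving involution, `π : Ω → T` any map.  Suppose
(i) *fibrewise positive correlation*: for all monotone `a b : Ω → ℝ` and every `p`,
    `(Σ_{π u = p} μ u · a u)(Σ_{π u = p} μ u · b u) ≤ (Σ_{π u = p} μ u) · Σ_{π u = p} μ u · a u · b u`;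
(ii) *fibrewise sign coherence*: for every `p`, either `Σ_{π u = p} μ u (f u − f(ι u)) ≤ 0` for all monotone `f`, or `≥ 0` for all monotone `f`.
Then `Ω` is antipodal Kleitman. [this work] -/
theorem ak_of_fibres (μ : Ω → ℝ) (hμ : ∀ u, 0 ≤ μ u) (ι : Ω → Ω) (hιι : Function.Involutive ι) (hμι : ∀ u, μ (ι u) = μ u)
    (hι : ∀ u v : Ω, u ≤ v → ι v ≤ ι u) (π : Ω → T)
    (hH : ∀ a b : Ω → ℝ, Monotone a → Monotone b → ∀ p : T,
      (∑ u ∈ univ.filter (fun u => π u = p), μ u * a u) * (∑ u ∈ univ.filter (fun u => π u = p), μ u * b u)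
        ≤ (∑ u ∈ univ.filter (fun u => π u = p), μ u) * ∑ u ∈ univ.filter (fun u => π u = p), μ u * (a u * b u))
    (hS : ∀ p : T, (∀ f : Ω → ℝ, Monotone f → ∑ u ∈ univ.filter (fun u => π u = p), μ u * (f u - f (ι u)) ≤ 0) ∨
                   (∀ f : Ω → ℝ, Monotone f → 0 ≤ ∑ u ∈ univ.filter (fun u => π u = p), μ u * (f u - f (ι u))))
    (f g : Ω → ℝ) (hf : Monotone f) (hg : Monotone g) :
    0 ≤ ∑ u, μ u * (f u * (g u - g (ι u))) := by
  classical
  rw [sum_mul_sub_eq_half μ ι hιι hμι f g]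
  refine mul_nonneg (by norm_num) ?_
  -- split over the fibres of π
  rw [← Finset.sum_fiberwise_of_maps_to (s := (univ : Finset Ω)) (t := (univ : Finset T)) (g := π) (fun u _ => mem_univ _)
    (fun u => μ u * ((f u - f (ι u)) * (g u - g (ι u))))]
  refine Finset.sum_nonneg (fun p _ => ?_)
  set Fp := univ.filter (fun u => π u = p) with hFp
  set F : Ω → ℝ := fun u => f u - f (ι u) with hF
  set G : Ω → ℝ := fun u => g u - g (ι u) with hG
  have hFm : Monotone F := monotone_sub_comp ι hι f hf
  have hGm : Monotone G := monotone_sub_comp ι hι g hg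
  have hcorr := hH F G hFm hGm p
  -- sign coherence gives 0 ≤ (Σ μF)(Σ μG)
  have hab : 0 ≤ (∑ u ∈ Fp, μ u * F u) * (∑ u ∈ Fp, μ u * G u) := by
    rcases hS p with h | h
    · exact mul_nonneg_of_nonpos_of_nonpos (h f hf) (h g hg)
    · exact mul_nonneg (h f hf) (h g hg)
  have hM : 0 ≤ ∑ u ∈ Fp, μ u := Finset.sum_nonneg (fun u _ => hμ u)
  have hMc : 0 ≤ (∑ u ∈ Fp, μ u) * ∑ u ∈ Fp, μ u * (F u * G u) := le_trans hab hcorr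
  show 0 ≤ ∑ u ∈ Fp, μ u * ((f u - f (ι u)) * (g u - g (ι u)))
  change 0 ≤ ∑ u ∈ Fp, μ u * (F u * G u)
  rcases lt_or_eq_of_le hM with hpos | hzero
  · by_contra hneg
    have hneg' : ∑ u ∈ Fp, μ u * (F u * G u) < 0 := lt_of_not_ge hneg
    have : (∑ u ∈ Fp, μ u) * ∑ u ∈ Fp, μ u * (F u * G u) < 0 := mul_neg_of_pos_of_neg hpos hneg'
    linarith
  · -- fibre of mass zero: every weight vanishes
    have hz : ∀ u ∈ Fp, μ u = 0 := by
      have := (Finset.sum_eq_zero_iff_of_nonneg (fun u (_ : u ∈ Fp) => hμ u)).1 hzero.symm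
      exact this
    rw [Finset.sum_eq_zero (fun u hu => by rw [hz u hu, zero_mul])]

omit [Fintype T] in
/-- **Matching criterion for sign coherence (the 'flip').**  If `Φ` maps the fibre `F = {π = p}` injectively onto its antipode `ι(F)`, preserves
`μ` on `F`, and satisfies `u ≤ Φ u` on `F`, then `Σ_F μ (f − f∘ι) ≤ 0` for every monotone `f`. [this work] -/
theorem oddMass_nonpos_of_matching [DecidableEq Ω] (μ : Ω → ℝ) (hμ : ∀ u, 0 ≤ μ u) (ι : Ω → Ω) (hιι : Function.Involutive ι)
    (hμι : ∀ u, μ (ι u) = μ u) (π : Ω → T) (p : T) (Φ : Ω → Ω)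
    (hle : ∀ u, π u = p → u ≤ Φ u) (hμΦ : ∀ u, π u = p → μ (Φ u) = μ u)
    (hinj : Set.InjOn Φ ↑(univ.filter (fun u => π u = p)))
    (himg : (univ.filter (fun u => π u = p)).image Φ = (univ.filter (fun u => π u = p)).image ι)
    (f : Ω → ℝ) (hf : Monotone f) :
    ∑ u ∈ univ.filter (fun u => π u = p), μ u * (f u - f (ι u)) ≤ 0 := by
  set Fp := univ.filter (fun u => π u = p) with hFp
  -- Σ_F μ u f(ι u) = Σ_{ι F} μ v f v
  have hιsum : ∑ u ∈ Fp, μ u * f (ι u) = ∑ v ∈ Fp.image ι, μ v * f v := by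
    rw [Finset.sum_image (fun x _ y _ h => hιι.injective h)]
    refine Finset.sum_congr rfl (fun u _ => ?_)
    rw [hμι]
  -- Σ_{Φ F} μ v f v = Σ_F μ u f(Φ u)
  have hΦsum : ∑ v ∈ Fp.image Φ, μ v * f v = ∑ u ∈ Fp, μ u * f (Φ u) := by
    rw [Finset.sum_image (fun x hx y hy h => hinj hx hy h)]
    refine Finset.sum_congr rfl (fun u hu => ?_)
    rw [hμΦ u (Finset.mem_filter.1 hu).2]
  have hmono : ∑ u ∈ Fp, μ u * f u ≤ ∑ u ∈ Fp, μ u * f (Φ u) := by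
    refine Finset.sum_le_sum (fun u hu => ?_)
    exact mul_le_mul_of_nonneg_left (hf (hle u (Finset.mem_filter.1 hu).2)) (hμ u)
  have hsplit : ∑ u ∈ Fp, μ u * (f u - f (ι u)) = ∑ u ∈ Fp, μ u * f u - ∑ u ∈ Fp, μ u * f (ι u) := by
    rw [← Finset.sum_sub_distrib]
    refine Finset.sum_congr rfl (fun u _ => ?_)
    ring
  rw [hsplit, hιsum, ← himg, hΦsum]
  linarith

end Fibres

end AntitheticPicture

end Summit.CriticalPhenomena.PercolationContinuityZ3.Theorems
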